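import Summits.FinalStateConjecture.FinalStateConjecture.Theses.SwallowTheDatum
import Summits.FinalStateConjecture.FinalStateConjecture.Theorems.KerrShieldedDataExist.Negative.BentHeight
import Summits.FinalStateConjecture.FinalStateConjecture.Theorems.SwallowTheDatumParametricKerrBurialFamily
import Literature.Geometry.Lorentzian.SmoothDataFamilyLocal

/-!
# Vocabulary and glue of the line `receding-annulus-universal-collar` (crux `SwallowTheDatum.ParametricKerrBurial`,
# item stmt-FinalStateConjecture-10052)

Definitions-only support file plus the line's sorry-free COMPOSITION, so that the REGISTERED STUBS (landed one by one
as `--supports stmt-FinalStateConjecture-10052` files) and the lead's skeleton (`Cruxes/ParametricKerrBurial/Lines/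
receding-annulus-universal-collar.lean`, not importable) speak about the SAME declarations.  Nothing is asserted.
§0 vocabulary: `SmoothSectionsOn`, `AgreeAt`, `IsExactSchwarzschildBeyond`, `IsSchwarzschildAnnulus`, the crux's
shielding predicate `IsKerrShielded` (verbatim; `crux_iff := Iff.rfl` certifies it) and its located version
`IsKerrShieldedAway`.  §1 the junction lemma `junction` (pure differential topology over `SmoothDataFamilyLocal.lean`).
§2 `ParametricKerrBurial_of`: the FIVE registered stub statements (lead's reshape v2 of the planner's three —
`stub_splice` split into `stub_collarDilation`, `stub_transportPatch`, `stub_breathing`) imply the crux BY NAME.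
References: `Theses/SwallowTheDatum.lean` (item 10052); `Lines/receding-annulus-universal-collar.md`; Mao–Oh–Tao
arXiv:2308.13031 Thm 1.7/1.10; Li–Mei arXiv:2005.01249 Thm 2.2; Bartnik, CPAM 39 (1986) §1.
-/

-- `Summit.<Summit>.<Problem>` is the tree's mandated summit-side namespace (CONVENTIONS §2); for this
-- single-conjunct summit the two coincide, so the duplicate is deliberate.
set_option linter.dupNamespace false

noncomputable section

namespace Summit.FinalStateConjecture.FinalStateConjecture.Theorems.SwallowTheDatum.ParametricKerrBurial

open scoped Manifold ContDiff Topology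
open Bundle Set Filter Function Literature.Geometry.Lorentzian
open Summit.FinalStateConjecture.FinalStateConjecture.Theorems.KerrShieldedDataExist.Negative
  (bentHeight bentHeight_eq_literal)

/-! ## §0 Vocabulary -/

section Vocabulary

variable {X : Type} [TopologicalSpace X] [ChartedSpace E3 X] [IsManifold (𝓡 3) ∞ X]

/-- Joint smoothness, on `s ⊆ P × X`, of the two section maps `(p, x) ↦ h_{S p}(x)`, `(p, x) ↦ k_{S p}(x)` of a
family of data indexed by a manifold `P`; for `P = ℝ¹`, `s = univ` verbatim `InitialDataSet.IsSmoothDataFamily 1 S`.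
[folklore] -/
def SmoothSectionsOn {P : Type} [TopologicalSpace P] {EP : Type} [NormedAddCommGroup EP]
    [NormedSpace ℝ EP] {HP : Type} [TopologicalSpace HP] (IP : ModelWithCorners ℝ EP HP)
    [ChartedSpace HP P] (S : P → InitialDataSet (𝓡 3) X) (s : Set (P × X)) : Prop :=
  ContMDiffOn (IP.prod (𝓡 3)) ((𝓡 3).prod 𝓘(ℝ, E3 →L[ℝ] E3 →L[ℝ] ℝ)) ∞
      (fun p : P × X ↦
        TotalSpace.mk' (F := E3 →L[ℝ] E3 →L[ℝ] ℝ)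
          (E := fun x : X ↦ TangentSpace (𝓡 3) x →L[ℝ] TangentSpace (𝓡 3) x →L[ℝ] ℝ) p.2
          ((S p.1).h.inner p.2)) s ∧
    ContMDiffOn (IP.prod (𝓡 3)) ((𝓡 3).prod 𝓘(ℝ, E3 →L[ℝ] E3 →L[ℝ] ℝ)) ∞
      (fun p : P × X ↦
        TotalSpace.mk' (F := E3 →L[ℝ] E3 →L[ℝ] ℝ)
          (E := fun x : X ↦ TangentSpace (𝓡 3) x →L[ℝ] TangentSpace (𝓡 3) x →L[ℝ] ℝ) p.2
          ((S p.1).k p.2)) s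

/-- Two data `D`, `D'` on `X` have the same sections (metric and second fundamental form) at `x`. [folklore] -/
def AgreeAt (D D' : InitialDataSet (𝓡 3) X) (x : X) : Prop :=
  D.h.inner x = D'.h.inner x ∧ D.k x = D'.k x

/-- In the chart of the end `e`, `D` is EXACTLY time-symmetric isotropic Schwarzschild(`m`) beyond chart radius `ρ`:
`hCoeff = (1 + m/(2‖x‖))⁴ δ`, `kCoeff = 0` for `ρ < ‖x‖`. Bartnik, CPAM 39 (1986) §1. [folklore] -/
def IsExactSchwarzschildBeyond (e : AFEnd X) (D : InitialDataSet (𝓡 3) X) (m ρ : ℝ) : Prop :=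
  ∀ x : E3, ρ < ‖x‖ →
    AFEnd.hCoeff e D x = (1 + m / (2 * ‖x‖)) ^ 4 • (innerSL ℝ : E3 →L[ℝ] E3 →L[ℝ] ℝ) ∧
      AFEnd.kCoeff e D x = 0

/-- On `E3` (tangent spaces `= E3`): `C` is exactly isotropic Schwarzschild(`μ`), `k = 0`, on `{1 < ‖y‖ < 2}`.
[folklore] -/
def IsSchwarzschildAnnulus (C : InitialDataSet (𝓡 3) E3) (μ : ℝ) : Prop :=
  ∀ y : E3, 1 < ‖y‖ → ‖y‖ < 2 →
    C.h.inner y = (1 + μ / (2 * ‖y‖)) ^ 4 • (innerSL ℝ : E3 →L[ℝ] E3 →L[ℝ] ℝ) ∧ C.k y = 0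

/-- The SHIELDING PREDICATE of the crux, isolated VERBATIM (the `∀ c ≠ 0` conjunct of `ParametricKerrBurial`, the
hard-coded height written `bentHeight M a` — the crux's lambda by `bentHeight_eq_literal : … := rfl`; see `crux_iff`):
outside a compact set `D` is the exact bent Kerr–Schild/Boyer–Lindquist slice `{r > r₁}`, `r₋ < r₁ < r₊`, of a
sub-extremal Kerr. Li–Mei arXiv:2005.01249 §2.2 (notion); the route file (typing). [folklore] -/
def IsKerrShielded [Kerr.Facts] (X : Type) [TopologicalSpace X] [ChartedSpace E3 X]
    [IsManifold (𝓡 3) ∞ X] (D : InitialDataSet (𝓡 3) X) : Prop :=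
  ∃ (M a r₁ : ℝ) (hM : 0 ≤ M) (T : ℝ → ℝ) (φ : Kerr.slice a r₁ → X)
    (ψ : Kerr.slice a r₁ → Kerr.region a r₁) (ν : NormalField 𝓘(ℝ, E4) ψ),
    |a| < M ∧ Kerr.rMinus M a < r₁ ∧ r₁ < Kerr.rPlus M a ∧ T = bentHeight M a ∧
    IsCompact (Set.range φ)ᶜ ∧ Topology.IsOpenEmbedding φ ∧
    ContMDiff 𝓘(ℝ, E3) (𝓡 3) ∞ φ ∧
    (∀ y : Kerr.slice a r₁, (ψ y : E4) =
      E4.ofTimeSpace (T (Kerr.radius a (E4.ofTimeSpace 0 (y : E3)))) (y : E3)) ∧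
    (Kerr.smoothMetric M a r₁).IsSpacelikeImmersion 𝓘(ℝ, E3) ψ ∧
    (Kerr.smoothMetric M a r₁).IsFutureUnitNormal 𝓘(ℝ, E3)
      ((Kerr.timeOrientation M a r₁ hM).ofLE le_top) ψ ν ∧
    (∀ y : Kerr.slice a r₁,
      pullbackBilin (I := 𝓡 3) (I' := 𝓘(ℝ, E3)) φ D.h.inner y =
        pullbackBilin (I := 𝓘(ℝ, E4)) (I' := 𝓘(ℝ, E3)) ψ (Kerr.smoothMetric M a r₁).val y) ∧
    (∀ [(Kerr.smoothMetric M a r₁).HasLeviCivita] (y : Kerr.slice a r₁),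
      (pullbackBilin (I := 𝓡 3) (I' := 𝓘(ℝ, E3)) φ D.k y).toLinearMap₁₂ =
        (Kerr.smoothMetric M a r₁).secondFundamentalForm 𝓘(ℝ, E3) ψ ν y)

/-- `IsKerrShielded E3` with the shield LOCATED: the shielding chart ranges outside the closed ball of radius `ρ`
(a zero-spin shield forces `k ≢ 0` on its unbent zone, so a time-symmetric annulus must avoid it). [folklore] -/
def IsKerrShieldedAway [Kerr.Facts] (ρ : ℝ) (C : InitialDataSet (𝓡 3) E3) : Prop :=
  ∃ (M a r₁ : ℝ) (hM : 0 ≤ M) (T : ℝ → ℝ) (φ : Kerr.slice a r₁ → E3)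
    (ψ : Kerr.slice a r₁ → Kerr.region a r₁) (ν : NormalField 𝓘(ℝ, E4) ψ),
    (∀ z : Kerr.slice a r₁, ρ < ‖φ z‖) ∧
    |a| < M ∧ Kerr.rMinus M a < r₁ ∧ r₁ < Kerr.rPlus M a ∧ T = bentHeight M a ∧
    IsCompact (Set.range φ)ᶜ ∧ Topology.IsOpenEmbedding φ ∧
    ContMDiff 𝓘(ℝ, E3) (𝓡 3) ∞ φ ∧
    (∀ y : Kerr.slice a r₁, (ψ y : E4) =
      E4.ofTimeSpace (T (Kerr.radius a (E4.ofTimeSpace 0 (y : E3)))) (y : E3)) ∧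
    (Kerr.smoothMetric M a r₁).IsSpacelikeImmersion 𝓘(ℝ, E3) ψ ∧
    (Kerr.smoothMetric M a r₁).IsFutureUnitNormal 𝓘(ℝ, E3)
      ((Kerr.timeOrientation M a r₁ hM).ofLE le_top) ψ ν ∧
    (∀ y : Kerr.slice a r₁,
      pullbackBilin (I := 𝓡 3) (I' := 𝓘(ℝ, E3)) φ C.h.inner y =
        pullbackBilin (I := 𝓘(ℝ, E4)) (I' := 𝓘(ℝ, E3)) ψ (Kerr.smoothMetric M a r₁).val y) ∧
    (∀ [(Kerr.smoothMetric M a r₁).HasLeviCivita] (y : Kerr.slice a r₁),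
      (pullbackBilin (I := 𝓡 3) (I' := 𝓘(ℝ, E3)) φ C.k y).toLinearMap₁₂ =
        (Kerr.smoothMetric M a r₁).secondFundamentalForm 𝓘(ℝ, E3) ψ ν y)

/-- A located shield is a shield. [folklore] -/
theorem IsKerrShieldedAway.isKerrShielded [Kerr.Facts] {ρ : ℝ} {C : InitialDataSet (𝓡 3) E3}
    (h : IsKerrShieldedAway ρ C) : IsKerrShielded E3 C := by
  obtain ⟨M, a, r₁, hM, T, φ, ψ, ν, -, hrest⟩ := h
  exact ⟨M, a, r₁, hM, T, φ, ψ, ν, hrest⟩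

end Vocabulary

/-- **The vocabulary is the route's**: the crux unfolds definitionally to "through every admissible `d` passes a
smooth injective admissible family whose `c ≠ 0` members are `IsKerrShielded`". [folklore] -/
theorem crux_iff :
    Summit.FinalStateConjecture.FinalStateConjecture.Theses.SwallowTheDatum.ParametricKerrBurial ↔
      ∀ [Kerr.Facts] (X : Type) [TopologicalSpace X] [ChartedSpace E3 X]
        [IsManifold (𝓡 3) ∞ X] [T2Space X] [SecondCountableTopology X] [ConnectedSpace X],
        ∀ d ∈ admissibleVacuumData X,
          ∃ F : EuclideanSpace ℝ (Fin 1) → InitialDataSet (𝓡 3) X,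
            InitialDataSet.IsSmoothDataFamily 1 F ∧ F 0 = d ∧ Function.Injective F ∧
              (∀ c, F c ∈ admissibleVacuumData X) ∧ ∀ c ≠ 0, IsKerrShielded X (F c) :=
  Iff.rfl

/-! ## §1 The junction lemma (proved) -/

section Junction

variable {X : Type} [TopologicalSpace X] [ChartedSpace E3 X] [IsManifold (𝓡 3) ∞ X]

/-- The radius map `c ↦ R⋆ + 1 + ‖c‖⁻²` of the reparametrisation (junk at `c = 0`). [folklore] -/
def radiusOf (Rstar : ℝ) (c : EuclideanSpace ℝ (Fin 1)) : ℝ := Rstar + 1 + (‖c‖ ^ 2)⁻¹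

/-- The breathing amplitude `c ↦ arctan(c₀)/2 ∈ (−π/4, π/4)` (smooth, injective, vanishing at `0`). [folklore] -/
def angleOf (c : EuclideanSpace ℝ (Fin 1)) : ℝ := Real.arctan (c 0) / 2

/-- `R⋆ < R⋆ + 1 + ‖c‖⁻²`. [folklore] -/
theorem radiusOf_gt (Rstar : ℝ) (c : EuclideanSpace ℝ (Fin 1)) : Rstar < radiusOf Rstar c := by
  have : 0 ≤ (‖c‖ ^ 2)⁻¹ := inv_nonneg.2 (sq_nonneg _)
  unfold radiusOf; linarith

/-- The radius map is smooth off `c = 0`. [folklore] -/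
theorem contDiffOn_radiusOf (Rstar : ℝ) :
    ContDiffOn ℝ ∞ (radiusOf Rstar) {c : EuclideanSpace ℝ (Fin 1) | c ≠ 0} := by
  refine contDiffOn_const.add ((contDiff_norm_sq ℝ).contDiffOn.inv fun c hc ↦ ?_)
  exact pow_ne_zero 2 (norm_ne_zero_iff.2 hc)

/-- Small nonzero parameters have large radius: `‖c‖ < min 1 ρ₃⁻¹`, `1 ≤ ρ₃` give `ρ₃ < ‖c‖⁻²`. [folklore] -/
theorem lt_inv_norm_sq {c : EuclideanSpace ℝ (Fin 1)} (hc : c ≠ 0) {ρ₃ : ℝ} (hρ₃ : 1 ≤ ρ₃)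
    (h1 : ‖c‖ < 1) (h2 : ‖c‖ < ρ₃⁻¹) : ρ₃ < (‖c‖ ^ 2)⁻¹ := by
  have hcpos : 0 < ‖c‖ := norm_pos_iff.2 hc
  have hsq : ‖c‖ ^ 2 ≤ ‖c‖ := by nlinarith
  have hρ₃pos : 0 < ρ₃ := by linarith
  rw [lt_inv_comm₀ hρ₃pos (by positivity)]
  exact lt_of_le_of_lt hsq h2

/-- The amplitude map is smooth. [folklore] -/
theorem contDiff_angleOf : ContDiff ℝ ∞ angleOf :=
  (Real.contDiff_arctan.comp (EuclideanSpace.proj (0 : Fin 1)).contDiff).div_const _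

/-- The amplitude vanishes at `c = 0`. [folklore] -/
theorem angleOf_zero : angleOf 0 = 0 := by simp [angleOf]

/-- `|arctan(c₀)/2| < π/4 < 1`. [folklore] -/
theorem angleOf_mem_Ioo (c : EuclideanSpace ℝ (Fin 1)) : angleOf c ∈ Set.Ioo (-1 : ℝ) 1 := by
  have h1 := Real.arctan_lt_pi_div_two (c 0)
  have h2 := Real.neg_pi_div_two_lt_arctan (c 0)
  have hπ := Real.pi_lt_four
  constructor <;> · unfold angleOf; linarith

/-- The amplitude map is injective on `ℝ¹` (`arctan` is). [folklore] -/
theorem angleOf_injective : Function.Injective angleOf := by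
  intro c c' h
  have h0 : c 0 = c' 0 := Real.arctan_injective (by unfold angleOf at h; linarith)
  ext i
  rw [Subsingleton.elim i 0]; exact h0

open Classical in
/-- The reparametrised family: `F 0 = d`, `F c = S (R⋆ + 1 + ‖c‖⁻², arctan(c₀)/2)` for `c ≠ 0`. [folklore] -/
def family (d : InitialDataSet (𝓡 3) X) (Rstar : ℝ) (S : ℝ × ℝ → InitialDataSet (𝓡 3) X)
    (c : EuclideanSpace ℝ (Fin 1)) : InitialDataSet (𝓡 3) X :=
  if c = 0 then d else S (radiusOf Rstar c, angleOf c)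

/-- `F 0 = d`. [folklore] -/
theorem family_zero (d : InitialDataSet (𝓡 3) X) (Rstar : ℝ) (S : ℝ × ℝ → InitialDataSet (𝓡 3) X) :
    family d Rstar S 0 = d := by
  simp [family]

/-- `F c = S (R c, θ c)` for `c ≠ 0`. [folklore] -/
theorem family_of_ne (d : InitialDataSet (𝓡 3) X) (Rstar : ℝ) (S : ℝ × ℝ → InitialDataSet (𝓡 3) X)
    {c : EuclideanSpace ℝ (Fin 1)} (hc : c ≠ 0) : family d Rstar S c = S (radiusOf Rstar c, angleOf c) := by
  simp [family, hc]

omit [IsManifold (𝓡 3) ∞ X] in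
/-- The parameter map `(c, x) ↦ ((R c, θ c), x)` is smooth off `c = 0`. [folklore] -/
theorem contMDiffOn_paramMap (Rstar : ℝ) :
    ContMDiffOn (𝓘(ℝ, EuclideanSpace ℝ (Fin 1)).prod (𝓡 3)) ((𝓘(ℝ, ℝ).prod 𝓘(ℝ, ℝ)).prod (𝓡 3)) ∞
      (fun q : EuclideanSpace ℝ (Fin 1) × X ↦ ((radiusOf Rstar q.1, angleOf q.1), q.2)) {q | q.1 ≠ 0} :=
  ((((contDiffOn_radiusOf Rstar).contMDiffOn).comp contMDiffOn_fst fun _ hq ↦ hq).prodMk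
    (contDiff_angleOf.contMDiff.comp_contMDiffOn contMDiffOn_fst)).prodMk contMDiffOn_snd

omit [IsManifold (𝓡 3) ∞ X] in
/-- The comparison parameter map `(c, x) ↦ (θ c, x)` is smooth everywhere. [folklore] -/
theorem contMDiff_compMap :
    ContMDiff (𝓘(ℝ, EuclideanSpace ℝ (Fin 1)).prod (𝓡 3)) (𝓘(ℝ, ℝ).prod (𝓡 3)) ∞
      (fun q : EuclideanSpace ℝ (Fin 1) × X ↦ (angleOf q.1, q.2)) :=
  (contDiff_angleOf.contMDiff.comp contMDiff_fst).prodMk contMDiff_snd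

/-- Core of the junction lemma for ONE section selector `σ` (`h` or `k`): the section of the reparametrised family
is smooth — off `c = 0` by composition, at `c = 0` by local exhaustion and eventual agreement. [folklore] -/
theorem contMDiff_family_section (d : InitialDataSet (𝓡 3) X) (e : AFEnd X) (Rstar : ℝ)
    (S : ℝ × ℝ → InitialDataSet (𝓡 3) X) (E : ℝ → InitialDataSet (𝓡 3) X)
    (σ : InitialDataSet (𝓡 3) X → (x : X) → (TangentSpace (𝓡 3) x →L[ℝ] TangentSpace (𝓡 3) x →L[ℝ] ℝ))
    (hS : ContMDiffOn ((𝓘(ℝ, ℝ).prod 𝓘(ℝ, ℝ)).prod (𝓡 3)) ((𝓡 3).prod 𝓘(ℝ, E3 →L[ℝ] E3 →L[ℝ] ℝ)) ∞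
      (fun p : (ℝ × ℝ) × X ↦
        TotalSpace.mk' (F := E3 →L[ℝ] E3 →L[ℝ] ℝ)
          (E := fun x : X ↦ TangentSpace (𝓡 3) x →L[ℝ] TangentSpace (𝓡 3) x →L[ℝ] ℝ) p.2
          (σ (S p.1) p.2)) {p | Rstar < p.1.1})
    (hE : ContMDiffOn (𝓘(ℝ, ℝ).prod (𝓡 3)) ((𝓡 3).prod 𝓘(ℝ, E3 →L[ℝ] E3 →L[ℝ] ℝ)) ∞
      (fun p : ℝ × X ↦
        TotalSpace.mk' (F := E3 →L[ℝ] E3 →L[ℝ] ℝ)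
          (E := fun x : X ↦ TangentSpace (𝓡 3) x →L[ℝ] TangentSpace (𝓡 3) x →L[ℝ] ℝ) p.2
          (σ (E p.1) p.2)) Set.univ)
    (hE0 : ∀ x, σ (E 0) x = σ d x)
    (hSE : ∀ R t : ℝ, Rstar < R → ∀ x ∉ e.far R, σ (S (R, t)) x = σ (E t) x) :
    ContMDiff (𝓘(ℝ, EuclideanSpace ℝ (Fin 1)).prod (𝓡 3)) ((𝓡 3).prod 𝓘(ℝ, E3 →L[ℝ] E3 →L[ℝ] ℝ)) ∞
      (fun q : EuclideanSpace ℝ (Fin 1) × X ↦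
        TotalSpace.mk' (F := E3 →L[ℝ] E3 →L[ℝ] ℝ)
          (E := fun x : X ↦ TangentSpace (𝓡 3) x →L[ℝ] TangentSpace (𝓡 3) x →L[ℝ] ℝ) q.2
          (σ (family d Rstar S q.1) q.2)) := by
  rintro ⟨c, x⟩
  by_cases hc : c = 0
  · -- at the junction: agree with the comparison family near `(0, x)`
    subst hc
    have hcomp := contMDiffOn_univ.1
      (hE.comp contMDiff_compMap.contMDiffOn (fun _ _ ↦ Set.mem_univ _) (s := Set.univ))
    apply (hcomp (0, x)).congr_of_eventuallyEq
    obtain ⟨V, hV, ρ₀, hVρ⟩ := AFEnd.exists_nhds_forall_not_mem_far e x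
    set ρ₃ : ℝ := max (ρ₀ - Rstar - 1) 1 with hρ₃
    have hρ₃1 : 1 ≤ ρ₃ := le_max_right _ _
    have hε : 0 < min 1 ρ₃⁻¹ := lt_min one_pos (inv_pos.2 (by linarith))
    have hN : Metric.ball (0 : EuclideanSpace ℝ (Fin 1)) (min 1 ρ₃⁻¹) ×ˢ V ∈ 𝓝 ((0 : EuclideanSpace ℝ (Fin 1)), x) :=
      prod_mem_nhds (Metric.ball_mem_nhds _ hε) hV
    filter_upwards [hN] with q ⟨hq1, hq2⟩
    rw [Metric.mem_ball, dist_zero_right] at hq1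
    by_cases hq0 : q.1 = 0
    · simp only [Function.comp_apply, hq0, family_zero, angleOf_zero, hE0]
    · have hfar : q.2 ∉ e.far (radiusOf Rstar q.1) := by
        refine hVρ _ ?_ _ hq2
        have := lt_inv_norm_sq hq0 hρ₃1 (lt_of_lt_of_le hq1 (min_le_left _ _))
          (lt_of_lt_of_le hq1 (min_le_right _ _))
        have h' : ρ₀ - Rstar - 1 ≤ ρ₃ := le_max_left _ _
        unfold radiusOf; linarith
      simp only [Function.comp_apply, family_of_ne _ _ _ hq0, hSE _ _ (radiusOf_gt Rstar q.1) _ hfar]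
  · -- off the junction: composition with the parameter map
    have hopen : IsOpen {q : EuclideanSpace ℝ (Fin 1) × X | q.1 ≠ 0} := isOpen_ne.preimage continuous_fst
    have hcomp := hS.comp (contMDiffOn_paramMap (X := X) Rstar) (fun q _ ↦ radiusOf_gt Rstar q.1)
    exact (hcomp.congr fun q hq ↦ by simp only [Function.comp_apply, family_of_ne _ _ _ hq]).contMDiffAt
      (hopen.mem_nhds hc)

/-- **The junction lemma** (pure differential topology): a radius–breathing family `S (R, t)`, smooth on
`{R⋆ < R} × ℝ × X`, agreeing off `e.far R` with a smooth comparison family `E t` (`E 0 = d`) whose MARKER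
`t ↦ h_{E t}(x₀)(v₀, v₀)` at `x₀ ∉ e.far R⋆` is injective on `(−1, 1)`, reparametrises (`F c := S (R⋆ + 1 + ‖c‖⁻²,
arctan(c₀)/2)`, `F 0 := d`) into a typed smooth family through `d` (smooth at `c = 0` by local exhaustion
`AFEnd.exists_nhds_forall_not_mem_far`), injective on `ℝ¹` (marker read at `x₀`), with every `F c`, `c ≠ 0`, some
`S (R, t)`, `R > R⋆`, `|t| < 1`. [folklore] -/
theorem junction (d : InitialDataSet (𝓡 3) X) (e : AFEnd X) (Rstar : ℝ)
    (S : ℝ × ℝ → InitialDataSet (𝓡 3) X) (E : ℝ → InitialDataSet (𝓡 3) X) (x₀ : X)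
    (v₀ : TangentSpace (𝓡 3) x₀)
    (hS : SmoothSectionsOn (𝓘(ℝ, ℝ).prod 𝓘(ℝ, ℝ)) S {p : (ℝ × ℝ) × X | Rstar < p.1.1})
    (hE : SmoothSectionsOn 𝓘(ℝ, ℝ) E (Set.univ : Set (ℝ × X)))
    (hE0 : E 0 = d)
    (hSE : ∀ R t : ℝ, Rstar < R → ∀ x ∉ e.far R, AgreeAt (S (R, t)) (E t) x)
    (hx₀ : x₀ ∉ e.far Rstar)
    (hmark : Set.InjOn (fun t : ℝ ↦ (E t).h.inner x₀ v₀ v₀) (Set.Ioo (-1) 1)) :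
    ∃ F : EuclideanSpace ℝ (Fin 1) → InitialDataSet (𝓡 3) X,
      InitialDataSet.IsSmoothDataFamily 1 F ∧ F 0 = d ∧ Function.Injective F ∧
      ∀ c ≠ 0, ∃ R t : ℝ, Rstar < R ∧ |t| < 1 ∧ F c = S (R, t) := by
  refine ⟨family d Rstar S, ?_, family_zero d Rstar S, ?_, fun c hc ↦
    ⟨radiusOf Rstar c, angleOf c, radiusOf_gt Rstar c, abs_lt.2 (angleOf_mem_Ioo c),
      family_of_ne d Rstar S hc⟩⟩
  · -- smooth family: both sections, by the one-selector core lemma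
    refine ⟨contMDiff_family_section d e Rstar S E (fun D x ↦ D.h.inner x) hS.1 hE.1
        (fun x ↦ by rw [hE0]) (fun R t hR x hx ↦ (hSE R t hR x hx).1), ?_⟩
    exact contMDiff_family_section d e Rstar S E (fun D x ↦ D.k x) hS.2 hE.2
        (fun x ↦ by rw [hE0]) (fun R t hR x hx ↦ (hSE R t hR x hx).2)
  · -- injective: read the marker at `x₀`
    intro c c' hcc'
    have hread : ∀ c : EuclideanSpace ℝ (Fin 1),
        (family d Rstar S c).h.inner x₀ v₀ v₀ = (E (angleOf c)).h.inner x₀ v₀ v₀ := by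
      intro c
      by_cases hc : c = 0
      · subst hc
        rw [family_zero, angleOf_zero, hE0]
      · have hfar : x₀ ∉ e.far (radiusOf Rstar c) :=
          fun h ↦ hx₀ (e.far_mono (le_of_lt (radiusOf_gt Rstar c)) h)
        rw [family_of_ne d Rstar S hc, (hSE _ _ (radiusOf_gt Rstar c) x₀ hfar).1]
    have hm : (E (angleOf c)).h.inner x₀ v₀ v₀ = (E (angleOf c')).h.inner x₀ v₀ v₀ := by
      rw [← hread c, ← hread c', hcc']
    exact angleOf_injective (hmark (angleOf_mem_Ioo c) (angleOf_mem_Ioo c') hm)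

end Junction

/-! ## §2 The composition: the five registered stubs of the line conclude the crux BY NAME -/

/-- **`ParametricKerrBurial` from the five stubs of the line** (CONDITIONAL glue; hypotheses = the registered
signatures of `stub_farGluing`, `stub_collarDatum`, `stub_collarDilation`, `stub_transportPatch`, `stub_breathing`
verbatim): A gives `η, e, R⋆, m, G`; B at `μ₀ := η/32` the collar `C`; dilation the collar family `Cfam`; transport +
patch the radius-indexed admissible shielded family `P` with `P R = G R` off `e.far (32R)`, hence `= d` off `e.far R`
(`far_mono`); breathing the families `S, E` and the marker; `junction` the family `F`. [folklore] -/
theorem ParametricKerrBurial_of :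
    (∀ (X : Type) [TopologicalSpace X] [ChartedSpace E3 X] [IsManifold (𝓡 3) ∞ X] [T2Space X]
      [SecondCountableTopology X] [ConnectedSpace X], ∀ d ∈ admissibleVacuumData X,
      ∃ (η : ℝ) (e : AFEnd X) (Rstar : ℝ) (m : ℝ → ℝ) (G : ℝ → InitialDataSet (𝓡 3) X),
        0 < η ∧ e.IsSoleEnd ∧ e.R < Rstar ∧ ContDiff ℝ ∞ m ∧ SmoothSectionsOn 𝓘(ℝ, ℝ) G {p : ℝ × X | Rstar < p.1} ∧
        ∀ R : ℝ, Rstar < R → G R ∈ admissibleVacuumData X ∧ (∀ x ∉ e.far R, AgreeAt (G R) d x) ∧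
          η * R ≤ m R ∧ IsExactSchwarzschildBeyond e (G R) (m R) (32 * R)) →
    (∀ [Kerr.Facts], ∀ μ₀ : ℝ, 0 < μ₀ → ∃ μ : ℝ, 0 < μ ∧ μ ≤ μ₀ ∧
      ∃ C ∈ admissibleVacuumData E3, IsSchwarzschildAnnulus C μ ∧ IsKerrShieldedAway 2 C) →
    (∀ [Kerr.Facts] (C : InitialDataSet (𝓡 3) E3) (μ : ℝ), 0 < μ → C ∈ admissibleVacuumData E3 →
      IsSchwarzschildAnnulus C μ → IsKerrShieldedAway 2 C → ∃ Cfam : ℝ → InitialDataSet (𝓡 3) E3,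
        SmoothSectionsOn 𝓘(ℝ, ℝ) Cfam {p : ℝ × E3 | 0 < p.1} ∧ ∀ l : ℝ, 0 < l → Cfam l ∈ admissibleVacuumData E3 ∧
          (∀ y : E3, l < ‖y‖ → ‖y‖ < 2 * l → (Cfam l).h.inner y =
              (1 + l * μ / (2 * ‖y‖)) ^ 4 • (innerSL ℝ : E3 →L[ℝ] E3 →L[ℝ] ℝ) ∧ (Cfam l).k y = 0) ∧
          IsKerrShieldedAway (2 * l) (Cfam l)) →
    (∀ [Kerr.Facts] (X : Type) [TopologicalSpace X] [ChartedSpace E3 X] [IsManifold (𝓡 3) ∞ X]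
      [T2Space X] [SecondCountableTopology X] [ConnectedSpace X] (e : AFEnd X) (Rstar η μ : ℝ) (m : ℝ → ℝ)
      (G : ℝ → InitialDataSet (𝓡 3) X) (Cfam : ℝ → InitialDataSet (𝓡 3) E3), e.IsSoleEnd → e.R < Rstar → 0 < μ →
      32 * μ ≤ η → ContDiff ℝ ∞ m → SmoothSectionsOn 𝓘(ℝ, ℝ) G {p : ℝ × X | Rstar < p.1} →
      (∀ R : ℝ, Rstar < R → G R ∈ admissibleVacuumData X ∧ η * R ≤ m R ∧
        IsExactSchwarzschildBeyond e (G R) (m R) (32 * R)) →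
      SmoothSectionsOn 𝓘(ℝ, ℝ) Cfam {p : ℝ × E3 | 0 < p.1} →
      (∀ l : ℝ, 0 < l → Cfam l ∈ admissibleVacuumData E3 ∧
        (∀ y : E3, l < ‖y‖ → ‖y‖ < 2 * l → (Cfam l).h.inner y =
            (1 + l * μ / (2 * ‖y‖)) ^ 4 • (innerSL ℝ : E3 →L[ℝ] E3 →L[ℝ] ℝ) ∧ (Cfam l).k y = 0) ∧
        IsKerrShieldedAway (2 * l) (Cfam l)) →
      ∃ P : ℝ → InitialDataSet (𝓡 3) X, SmoothSectionsOn 𝓘(ℝ, ℝ) P {p : ℝ × X | Rstar < p.1} ∧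
        ∀ R : ℝ, Rstar < R → P R ∈ admissibleVacuumData X ∧ IsKerrShielded X (P R) ∧
          ∀ x ∉ e.far (32 * R), AgreeAt (P R) (G R) x) →
    (∀ [Kerr.Facts] (X : Type) [TopologicalSpace X] [ChartedSpace E3 X] [IsManifold (𝓡 3) ∞ X]
      [T2Space X] [SecondCountableTopology X] [ConnectedSpace X] (d : InitialDataSet (𝓡 3) X) (e : AFEnd X)
      (Rstar : ℝ) (P : ℝ → InitialDataSet (𝓡 3) X), e.R < Rstar →
      SmoothSectionsOn 𝓘(ℝ, ℝ) P {p : ℝ × X | Rstar < p.1} →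
      (∀ R : ℝ, Rstar < R → P R ∈ admissibleVacuumData X ∧ IsKerrShielded X (P R) ∧
        ∀ x ∉ e.far R, AgreeAt (P R) d x) →
      ∃ (S : ℝ × ℝ → InitialDataSet (𝓡 3) X) (E : ℝ → InitialDataSet (𝓡 3) X) (x₀ : X)
        (v₀ : TangentSpace (𝓡 3) x₀),
        SmoothSectionsOn (𝓘(ℝ, ℝ).prod 𝓘(ℝ, ℝ)) S {p : (ℝ × ℝ) × X | Rstar < p.1.1} ∧
        SmoothSectionsOn 𝓘(ℝ, ℝ) E (Set.univ : Set (ℝ × X)) ∧ E 0 = d ∧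
        (∀ R t : ℝ, Rstar < R → ∀ x ∉ e.far R, AgreeAt (S (R, t)) (E t) x) ∧ x₀ ∉ e.far Rstar ∧
        Set.InjOn (fun t : ℝ ↦ (E t).h.inner x₀ v₀ v₀) (Set.Ioo (-1) 1) ∧
        ∀ R t : ℝ, Rstar < R → |t| < 1 → S (R, t) ∈ admissibleVacuumData X ∧ IsKerrShielded X (S (R, t))) →
    Summit.FinalStateConjecture.FinalStateConjecture.Theses.SwallowTheDatum.ParametricKerrBurial := by
  intro hA hB hDil hPatch hBreathe _inst X _ _ _ _ _ _ d hd
  obtain ⟨η, e, Rstar, m, G, hη, hsole, heR, hm, hGs, hG⟩ := hA X d hd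
  obtain ⟨μ, hμ, hμle, C, hCadm, hCann, hCsh⟩ := hB (η / 32) (by positivity)
  have h32 : 32 * μ ≤ η := by linarith
  obtain ⟨Cfam, hCs, hCfam⟩ := hDil C μ hμ hCadm hCann hCsh
  obtain ⟨P, hPs, hP⟩ := hPatch X e Rstar η μ m G Cfam hsole heR hμ h32 hm hGs
    (fun R hR ↦ ⟨(hG R hR).1, (hG R hR).2.2.1, (hG R hR).2.2.2⟩) hCs hCfam
  have hRpos : ∀ R : ℝ, Rstar < R → 0 ≤ R := fun R hR ↦ by linarith [e.R_pos]
  have hPd : ∀ R : ℝ, Rstar < R → P R ∈ admissibleVacuumData X ∧ IsKerrShielded X (P R) ∧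
      ∀ x ∉ e.far R, AgreeAt (P R) d x := by
    intro R hR
    refine ⟨(hP R hR).1, (hP R hR).2.1, fun x hx ↦ ?_⟩
    have hx' : x ∉ e.far (32 * R) := fun h ↦ hx (e.far_mono (by nlinarith [hRpos R hR]) h)
    obtain ⟨h1, h2⟩ := (hP R hR).2.2 x hx'
    obtain ⟨h3, h4⟩ := (hG R hR).2.1 x hx
    exact ⟨h1.trans h3, h2.trans h4⟩
  obtain ⟨S, E, x₀, v₀, hSs, hEs, hE0, hSE, hx₀, hmark, hgood⟩ := hBreathe X d e Rstar P heR hPs hPd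
  obtain ⟨F, hF, hF0, hFinj, hmem⟩ := junction d e Rstar S E x₀ v₀ hSs hEs hE0 hSE hx₀ hmark
  refine ⟨F, hF, hF0, hFinj, fun c ↦ ?_, fun c hc ↦ ?_⟩
  · by_cases hc : c = 0
    · subst hc; rw [hF0]; exact hd
    · obtain ⟨R, t, hR, ht, hFc⟩ := hmem c hc
      rw [hFc]; exact (hgood R t hR ht).1
  · obtain ⟨R, t, hR, ht, hFc⟩ := hmem c hc
    rw [hFc]; exact (hgood R t hR ht).2

end Summit.FinalStateConjecture.FinalStateConjecture.Theorems.SwallowTheDatum.ParametricKerrBurial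

end
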